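import Mathlib.MeasureTheory.Measure.Prod
import Summits.CriticalPhenomena.CardyFormulaZ2.Theorems.CardyFlipRussoSquareFromVoronoiHubDefs
import Summits.CriticalPhenomena.CardyFormulaZ2.Theorems.CardyFlipRussoTargetStubGsDictionary
import Literature.Probability.Percolation.SiteEmbDomainCrossing
import HarnessLib

/-!
# Vocabulary of the line `centre-decimation` for crux `SquareFromVoronoiHub`
# (stmt-CriticalPhenomena-6434, route `CardyFlipRusso`, sub-problem `CardyFormulaZ2`)

DEFINITIONS MODULE of the line (lead `prover-line-stmt-CriticalPhenomena-6434-c1-0`, 2026-08-16):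
the objects that the line skeleton `Cruxes/SquareFromVoronoiHub/Lines/evidence-Sketch-centre-decimation.lean`
posits, over tree declarations only, so that the stub files
`Theorems/CardyFlipRussoSquareFromVoronoiHubDecimation*.lean` and the assembly can refer to them BY
NAME.  Nothing is asserted here beyond `rfl` / dictionary bookkeeping.

The line (card `Cruxes/SquareFromVoronoiHub/Ideas/centre-decimation.md`): in the centred square
lattice `G_s = ℤ² ∪ (ℤ² + (½,½))` (`VoronoiBlocks.Gs`, `VoronoiBlocks.zGs`, landed module
`CardyFlipRussoSquareFromVoronoiHubDefs`) a face centre is adjacent only to the four corners of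
its face, so for site percolation at `1/2` it changes the connectivity of the `ℤ²`-sites exactly
when the open corners of the face (inside the window) are a DIAGONAL pair, and then it acts as an
independent fair coin; relabelling that coin by the corner colours (`decimate`) is a
measure-preserving bijection onto "fair site percolation on `ℤ²` plus one independent fair
diagonal per face" (`diagGraph`, `diagLaw`).  Hence the `G_s` connection probabilities between
sets of `ℤ²`-sites (`gsConn`) equal the random-diagonal ones (`diagConn`) — the
centre-decimation identity (stated in the skeleton; this module declares OBJECTS only, no
`Prop`s).  The crux's crude crossing event is squeezed between two such events (slacks `2δ` and
`3δ`), so Cardy's formula for the random-diagonal model at both slacks (crude events `diagCrude`,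
probabilities `diagCrossingProb`) gives the crux's conclusion.

Sources: the card; L. T. Rolla, *Percolation on the random-diagonal square lattice*
(arXiv:1704.04930), §1 (the annealed random-diagonal triangulation of `ℤ²`); V. Beffara,
*Is critical 2D percolation universal?* (2008), §5.1 (the lattice `G_s`).
-/

noncomputable section

open scoped Topology MeasureTheory
open Filter Set MeasureTheory
open Literature.Analysis.FunctionSpaces (PointConfig IsPoissonPointProcess)
open Literature.Probability.RandomPlanarGeometry (ConformalRectangle cardyFunction)
open Literature.Probability.Percolation (SiteConfig sitePercolation siteConnIn half
  centredSquareGraph centredSquareEmbedding)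
open Summit.CriticalPhenomena.CardyFormulaZ2.Cruxes.SquareFromVoronoiHub.VoronoiBlocks
  (zGs Gs crudeCrossing siteCrossingProb voronoiCrossingProb)

namespace Summit.CriticalPhenomena.CardyFormulaZ2.Cruxes.SquareFromVoronoiHub.CentreDecimation

/-! ### Dictionary: the crux's metric `G_s` is the tree's combinatorial `centredSquareGraph` -/

/-- The crux's vertex positions `zGs` ARE the tree's `centredSquareEmbedding` (same term).
[cite: Beffara2008Universal, §5.1] -/
theorem zGs_eq_centredSquareEmbedding : zGs = centredSquareEmbedding := rfl

/-- The crux's metric graph `Gs` IS the tree's combinatorial `centredSquareGraph` (`ℤ²`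
nearest-neighbour edges plus the four centre–corner edges of every face, no centre–centre edges):
the landed dictionary `CardyFlipRussoTarget.stub_gsDictionary`. [cite: Beffara2008Universal, §5.1] -/
theorem Gs_eq_centredSquareGraph : Gs = centredSquareGraph :=
  Summit.CriticalPhenomena.CardyFormulaZ2.Theorems.CardyFlipRussoTarget.stub_gsDictionary

/-! ### The random-diagonal square lattice -/

/-- **The square lattice with one diagonal per admitted face.**  Faces are indexed by their
lower-left corner `f ∈ ℤ²`; `B` is the set of admitted faces and `ζ` the orientation field: the
graph has the nearest-neighbour edges `x — x + e₁`, `x — x + e₂` of `ℤ²` and, for every admitted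
face `f ∈ B`, the SW–NE diagonal `f — f + (1,1)` if `f ∈ ζ` and the SE–NW diagonal
`f + (1,0) — f + (0,1)` if `f ∉ ζ` (Rolla, arXiv:1704.04930, §1, with the diagonals switched off
outside `B`). [cite: Rolla2019, §1] -/
def diagGraph (B ζ : Set (ℤ × ℤ)) : SimpleGraph (ℤ × ℤ) :=
  SimpleGraph.fromRel fun x y =>
    y = (x.1 + 1, x.2) ∨ y = (x.1, x.2 + 1) ∨
      (x ∈ B ∧ x ∈ ζ ∧ y = (x.1 + 1, x.2 + 1)) ∨
      ((x.1, x.2 - 1) ∈ B ∧ (x.1, x.2 - 1) ∉ ζ ∧ y = (x.1 + 1, x.2 - 1))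

/-- **The annealed random-diagonal law**: pairs `p = (ζ, σ)` of an i.i.d. fair orientation field
`ζ ⊆ ℤ²` (faces carrying the SW–NE diagonal) and, independently, i.i.d. fair site colours `σ ⊆ ℤ²`
(open sites). [cite: Rolla2019, §1] -/
def diagLaw : Measure (Set (ℤ × ℤ) × Set (ℤ × ℤ)) :=
  (sitePercolation (ℤ × ℤ) half).prod (sitePercolation (ℤ × ℤ) half)

/-! ### The two connection events compared by the decimation identity -/

/-- The `G_s` connection event between endpoint sets `U, V ⊆ ℤ²` inside the vertex window
`Sum.inl '' A ∪ Sum.inr '' B` (sites `A`, admitted centres `B`): some `u ∈ U` and `v ∈ V` are joined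
by an open `G_s`-path all of whose vertices lie in the window (the tree event `siteConnIn`).
[cite: Beffara2008Universal, §5.1] -/
def gsConn (A B U V : Set (ℤ × ℤ)) : Set (SiteConfig ((ℤ × ℤ) ⊕ (ℤ × ℤ))) :=
  {ω | ∃ u ∈ U, ∃ v ∈ V, ω ∈ siteConnIn Gs (Sum.inl '' A ∪ Sum.inr '' B) (Sum.inl u) (Sum.inl v)}

/-- The random-diagonal connection event between `U, V ⊆ ℤ²` inside the site window `A` with
diagonals admitted in the faces of `B`: for the pair `p = (ζ, σ)`, some `u ∈ U` and `v ∈ V` are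
joined by a `σ`-open path of `diagGraph B ζ` inside `A`. [cite: Rolla2019, §1] -/
def diagConn (A B U V : Set (ℤ × ℤ)) : Set (Set (ℤ × ℤ) × Set (ℤ × ℤ)) :=
  {p | ∃ u ∈ U, ∃ v ∈ V, p.2 ∈ siteConnIn (diagGraph B p.1) A u v}

/-! ### The decimation map (the coupling behind the identity) -/

/-- The set of faces `f` (lower-left corner) showing the ANTI-DIAGONAL PATTERN in the
configuration `ω` relative to the site window `A`: the open corners of `f` inside `A` are exactly
the SE and NW corners `f + (1,0)`, `f + (0,1)` (SW = `f` and NE = `f + (1,1)` are closed or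
outside `A`).  On exactly these faces the decimation map flips the centre coin. [cite: Rolla2019, §1] -/
def antiDiagFaces (A : Set (ℤ × ℤ)) (ω : SiteConfig ((ℤ × ℤ) ⊕ (ℤ × ℤ))) : Set (ℤ × ℤ) :=
  {f | ((f.1 + 1, f.2) ∈ A ∧ Sum.inl (f.1 + 1, f.2) ∈ ω) ∧ ((f.1, f.2 + 1) ∈ A ∧ Sum.inl (f.1, f.2 + 1) ∈ ω) ∧
    ¬ (f ∈ A ∧ Sum.inl f ∈ ω) ∧ ¬ ((f.1 + 1, f.2 + 1) ∈ A ∧ Sum.inl (f.1 + 1, f.2 + 1) ∈ ω)}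

/-- **The decimation map** `ω ↦ (ζ, σ)`: the site colours are kept (`σ = {x | inl x ∈ ω}`) and the
centre coin of the face `f` becomes the orientation of its diagonal, read as "SW–NE" (`f ∈ ζ`) iff
the centre is open — except on anti-diagonal faces, where the coin is flipped (so that there
"centre open" means "the SE–NW diagonal is present").  A measure-preserving bijection from
critical site percolation on `G_s` onto `diagLaw` carrying `gsConn A B U V` onto `diagConn A B U V`
(the content of the line's stubs). [cite: Rolla2019, §1] -/
def decimate (A : Set (ℤ × ℤ)) (ω : SiteConfig ((ℤ × ℤ) ⊕ (ℤ × ℤ))) :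
    Set (ℤ × ℤ) × Set (ℤ × ℤ) :=
  ({f | Sum.inr f ∈ ω ↔ f ∉ antiDiagFaces A ω}, {x | Sum.inl x ∈ ω})

/-! ### The crude crossing events of the random-diagonal model and the transferred crux -/

/-- The site window of the conformal rectangle `R` at mesh `δ`: sites `x ∈ ℤ²` with `δ x ∈ Ω`.
[cite: Beffara2008Universal, §5.1] -/
def siteWindow (R : ConformalRectangle) (δ : ℝ) : Set (ℤ × ℤ) :=
  {x | (δ : ℂ) * zGs (Sum.inl x) ∈ R.carrier}

/-- The face window of `R` at mesh `δ`: faces `f` whose centre `δ (f + (½,½))` lies in `Ω`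
(the admitted centres of `G_s`, the admitted diagonals of the random-diagonal model).
[cite: Beffara2008Universal, §5.1] -/
def faceWindow (R : ConformalRectangle) (δ : ℝ) : Set (ℤ × ℤ) :=
  {f | (δ : ℂ) * zGs (Sum.inr f) ∈ R.carrier}

/-- The sites of `ℤ²` whose position at mesh `δ` is within `c δ` of the boundary arc `arc i` of `R`.
[cite: Smirnov2001, §2] -/
def nearArc (R : ConformalRectangle) (i : Fin 4) (c δ : ℝ) : Set (ℤ × ℤ) :=
  {x | Metric.infDist ((δ : ℂ) * zGs (Sum.inl x)) (R.arc i) ≤ c * δ}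

/-- The crude crossing event of `R` at mesh `δ` with slack `c δ` for the random-diagonal model: an
open path of `diagGraph (faceWindow R δ) ζ` with all sites in `Ω`, from a site within `c δ` of the
arc `(ab)` to a site within `c δ` of the arc `(cd)`. [cite: Smirnov2001, §2] -/
def diagCrude (R : ConformalRectangle) (c δ : ℝ) : Set (Set (ℤ × ℤ) × Set (ℤ × ℤ)) :=
  diagConn (siteWindow R δ) (faceWindow R δ) (nearArc R 0 c δ) (nearArc R 2 c δ)

/-- The crude crossing probability of `R` at mesh `δ`, slack `c δ`, under the annealed
random-diagonal law. [cite: Rolla2019, §1] -/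
def diagCrossingProb (R : ConformalRectangle) (c δ : ℝ) : ℝ :=
  diagLaw.real (diagCrude R c δ)

end Summit.CriticalPhenomena.CardyFormulaZ2.Cruxes.SquareFromVoronoiHub.CentreDecimation

end
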